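import Summits.ValiantsHypothesis.ValiantsHypothesis.Theorems.RigidityForcesSymmetryRankRigidMinimalReprLaplaceResidualAssembly
import Summits.ValiantsHypothesis.ValiantsHypothesis.Theorems.RigidityForcesSymmetryRankRigidMinimalReprLaplaceResidualCase2

/-!
# `LaplaceOptimalFive`: a cheap decomposition of `P₅` has AT MOST TWO slices — unconditional
# (crux `RankRigidMinimalRepr`, stmt-ValiantsHypothesis-18034; frontier rung `LaplaceOptimalFive`, stmt-24813)

The close of the `a = 3` programme of the frontier rung `LaplaceOptimal 5` (val-lit-p8 g10/g11, val-width-24813-w1,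
val-port-2, val-lit-p3 g14; val-lit desk RULINGS #225/#246/#258/#260/#263).  In the OFFICIAL data format of the item
(`LaplaceOptimal 5`: split-rank-one terms `u_t(v|_{S_t}) · w_t(v|_{S_tᶜ})` summing to `[v injective]` on `Fin 5 → Fin 5`,
Laplace weight `Σ_t |S_t|! (5 − |S_t|)!`):

* `residual_four_configurations` — the hypothesis `hres` of `LaplaceFiveSlices.laplace_five_at_most_two_slices_of_residual`
  (p611251): each of the four residual sorted labelled three-slice configurations `(0; 01,02,12)`, `(0; 01,02,34)`,
  `(0; 01,12,34)`, `(0; 02,12,34)` is refuted — by val-port-2's `residual_of_case2` (transport to the two cut types + the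
  CASE-1 theorems `triangle_case1` / `outside_case1` of val-lit-p8 g11 when the slot-`0` slice vector is NOT a letter indicator)
  fed with this seat's CASE-2 theorems `triangle_case2` / `outside_case2` (slot-`0` slice vector a letter indicator; p617725).
* **`laplace_five_at_most_two_slices`** — every decomposition of `P₅` of total Laplace weight `< 120` has AT MOST TWO slice
  terms (`|S_t| ∈ {1, 4}`), UNCONDITIONALLY (`laplace_five_at_most_two_slices_of_case2`, p617885, with the two CASE-2 inputs).

With `laplace_five_at_most_three_slices` (p605460) and `laplace_five_three_slices_residual` (p611251) this settles the `a = 3`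
class of the rung's census: a cheap decomposition of `P₅`, if any, has `a ≤ 2` slices.
HONEST FRAMING: an exact PARTIAL result toward the frontier rung `LaplaceOptimalFive` (stmt-24813: weight `≥ 120`, i.e. NO cheap
decomposition at all), which stays OPEN — the `a ≤ 2` classes (`1 376 + …` maximal profiles) are untouched except through
`laplace_five_slot_contraction`; 24814 / the crux 18034 OPEN; no rung of record moves; nothing here bears on `VP ≠ VNP`, which is
NOT proved.
-/

set_option autoImplicit false

-- the mandated summit-side namespace repeats a component by design (single-problem summit)
set_option linter.dupNamespace false

namespace Summit.ValiantsHypothesis.ValiantsHypothesis.Theorems.RigidityForcesSymmetryRankRigidMinimalRepr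

namespace LaplaceResidual

open Finset

/-- **The residual hypothesis `hres`, discharged.**  Each of the four residual sorted labelled three-slice configurations of
`laplace_five_three_slices_residual` is refuted (normal-form format). [folklore] -/
theorem residual_four_configurations :
    ∀ (c : Fin 3) (p0 q0 p1 q1 p2 q2 : Fin 5),
      (c, p0, q0, p1, q1, p2, q2) ∈ ([(0, 0, 1, 0, 2, 1, 2), (0, 0, 1, 0, 2, 3, 4), (0, 0, 1, 1, 2, 3, 4), (0, 0, 2, 1, 2, 3, 4)] : List (Fin 3 × Fin 5 × Fin 5 × Fin 5 × Fin 5 × Fin 5 × Fin 5)) →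
      ∀ (α : Fin 3 → Fin 5 → ℂ) (W : Fin 3 → (Fin 5 → Fin 5) → ℂ),
        (∀ k, ∀ v v' : Fin 5 → Fin 5, (∀ j, j ≠ (![![0, 1, 2], ![0, 0, 1], ![0, 0, 0]] : Fin 3 → Fin 3 → Fin 5) c k → v j = v' j) → W k v = W k v') →
        ∀ (u' w' : Fin 3 → (Fin 5 → Fin 5) → ℂ),
          (∀ t, ∀ v v' : Fin 5 → Fin 5, v ((![p0, p1, p2] : Fin 3 → Fin 5) t) = v' ((![p0, p1, p2] : Fin 3 → Fin 5) t) →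
            v ((![q0, q1, q2] : Fin 3 → Fin 5) t) = v' ((![q0, q1, q2] : Fin 3 → Fin 5) t) → u' t v = u' t v') →
          (∀ t, ∀ v v' : Fin 5 → Fin 5, (∀ j, j ≠ (![p0, p1, p2] : Fin 3 → Fin 5) t →
            j ≠ (![q0, q1, q2] : Fin 3 → Fin 5) t → v j = v' j) → w' t v = w' t v') →
          ¬ ∀ v : Fin 5 → Fin 5, (if Function.Injective v then (1 : ℂ) else 0) =
            (∑ k, α k (v ((![![0, 1, 2], ![0, 0, 1], ![0, 0, 0]] : Fin 3 → Fin 3 → Fin 5) c k)) * W k v) + ∑ t, u' t v * w' t v :=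
  residual_of_case2
    (fun α W hW u w hu hw hind => triangle_case2 α W hW u w hu hw hind)
    (fun α W hW u w hu hw hind => outside_case2 α W hW u w hu hw hind)

/-- **A CHEAP DECOMPOSITION OF `P₅` HAS AT MOST TWO SLICES (unconditional).**  In the data format of `LaplaceOptimal 5`: if
split-rank-one terms `u_t(v|_{S_t}) · w_t(v|_{S_tᶜ})` sum to `[v injective]` on `Fin 5 → Fin 5` with total Laplace weight
`Σ_t |S_t|!·(5 − |S_t|)! < 120`, then FEWER THAN THREE of them are slices (`|S_t| = 1` or `4`) — stated as `< 3` (the `≤ 2` wording is the CONDITIONAL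
`LaplaceFiveSlices.laplace_five_at_most_two_slices_of` of val-width-24813-w1, whose hypotheses `hexA/hexB/hexC` this file does not
need; `Nat.lt_succ_iff` converts). [folklore] -/
theorem laplace_five_at_most_two_slices {N : ℕ} (T : Finset (Fin N)) (S : Fin N → Finset (Fin 5))
    (u w : Fin N → (Fin 5 → Fin 5) → ℂ)
    (hu : ∀ t, ∀ v v' : Fin 5 → Fin 5, (∀ i ∈ S t, v i = v' i) → u t v = u t v')
    (hw : ∀ t, ∀ v v' : Fin 5 → Fin 5, (∀ i, i ∉ S t → v i = v' i) → w t v = w t v')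
    (hsum : ∀ v : Fin 5 → Fin 5, (∑ t ∈ T, u t v * w t v) = if Function.Injective v then 1 else 0)
    (hlt : ∑ t ∈ T, (S t).card.factorial * (5 - (S t).card).factorial < 120) :
    (T.filter (fun t => (S t).card = 1 ∨ (S t).card = 4)).card < 3 :=
  Nat.lt_succ_of_le (laplace_five_at_most_two_slices_of_case2
    (fun α W hW u w hu hw hind => triangle_case2 α W hW u w hu hw hind)
    (fun α W hW u w hu hw hind => outside_case2 α W hW u w hu hw hind)
    T S u w hu hw hsum hlt)

end LaplaceResidual

end Summit.ValiantsHypothesis.ValiantsHypothesis.Theorems.RigidityForcesSymmetryRankRigidMinimalRepr
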